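import Summits.QuantumFields.YangMills.Theorems.SqueezedSkewnessLatticeBumps

/-!
# Amplitudes of lattice bumps (route-independent support for `SqueezedSkewness.HighBallFloorsLPGlue`,
# stmt-QuantumFields-22797)

For a bump `B` of outer radius `≤ s/2` centred at `s·u`, `u ∈ ℤ⁴`, the route's Källén–Lehmann amplitude
`amp_s B(μ,p) = Σ_{v∈ℤ⁴} B(sv) μ^{(v₀−1)⁺} e^{i s p·v⃗}` is the single term `μ^{(u₀−1)⁺} e^{i s p·u⃗}`; at a reciprocal-lattice
momentum `p = 2πq/(sS)` and a centre with spatial part `cc(z)`, `z ∈ (Fin S)³` (the route's centred coordinates), the phase is the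
character `e^{2πi (q·z)/S}`.  Plus the polarisation identity `‖a+b‖² − ‖a−b‖² = 4ab` for real amplitudes.  No definitions.
[folklore]
-/

noncomputable section

open scoped BigOperators
open Complex Finset
open Literature.MathematicalPhysics.QuantumLattice
open Summit.QuantumFields.YangMills.Theorems.SqueezedSkewnessLatticeBumps

namespace Summit.QuantumFields.YangMills.Theorems.SqueezedSkewnessHBAmps

/-- **Amplitude of a single lattice bump** = the term at its centre. [folklore] -/
theorem amp_bump {s : ℝ} (hs : 0 < s) (u : Fin 4 → ℤ) (B : ContDiffBump (s • siteToE (d := 4) u))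
    (hB : B.rOut ≤ s / 2) (μ : ℝ) (p : Fin 3 → ℝ) :
    ∑' v : Fin 4 → ℤ, ((((B : EuclideanSpace ℝ (Fin 4) → ℝ) (s • siteToE (d := 4) v) * μ ^ (Int.toNat (v 0 - 1))) : ℝ) : ℂ)
        * cexp (I * ((s * ∑ k : Fin 3, p k * (v k.succ : ℝ) : ℝ) : ℂ))
      = ((μ ^ (Int.toNat (u 0 - 1)) : ℝ) : ℂ) * cexp (I * ((s * ∑ k : Fin 3, p k * (u k.succ : ℝ) : ℝ) : ℂ)) := by
  have h := tsum_bump_mul hs u B hB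
    (fun v => ((μ ^ (Int.toNat (v 0 - 1)) : ℝ) : ℂ) * cexp (I * ((s * ∑ k : Fin 3, p k * (v k.succ : ℝ) : ℝ) : ℂ)))
  rw [← h]
  refine tsum_congr fun v => ?_
  push_cast
  ring

/-- The phase of a centre with spatial part `cc(z)` at a reciprocal-lattice momentum `2πq/(sS)` is the character
`e^{2πi (q·z)/S}` (the centred coordinate is `≡ z (mod S)`). [folklore] -/
theorem phase_cc {s : ℝ} (hs : s ≠ 0) (S : ℕ) (hS : 0 < S) (q : Fin 3 → ℤ) (t : ℤ) (z : Fin S × Fin S × Fin S) :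
    cexp (I * ((s * ∑ k : Fin 3, (2 * Real.pi * (q k : ℝ) / (s * S)) *
        ((![t, (if 2 * z.1.val < S then (z.1.val : ℤ) else (z.1.val : ℤ) - S),
            (if 2 * z.2.1.val < S then (z.2.1.val : ℤ) else (z.2.1.val : ℤ) - S),
            (if 2 * z.2.2.val < S then (z.2.2.val : ℤ) else (z.2.2.val : ℤ) - S)] : Fin 4 → ℤ) k.succ : ℝ) : ℝ) : ℂ))
      = cexp (2 * Real.pi * I * ((q 0 : ℂ) * ((z.1 : ℕ) : ℂ) + (q 1 : ℂ) * ((z.2.1 : ℕ) : ℂ) +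
          (q 2 : ℂ) * ((z.2.2 : ℕ) : ℂ)) / (S : ℂ)) := by
  have hS0 : (S : ℂ) ≠ 0 := by exact_mod_cast hS.ne'
  have hsC : (s : ℂ) ≠ 0 := by exact_mod_cast hs
  obtain ⟨j₁, hj₁⟩ := cc_emod S z.1
  obtain ⟨j₂, hj₂⟩ := cc_emod S z.2.1
  obtain ⟨j₃, hj₃⟩ := cc_emod S z.2.2
  have e : I * ((s * ∑ k : Fin 3, (2 * Real.pi * (q k : ℝ) / (s * S)) *
        ((![t, (if 2 * z.1.val < S then (z.1.val : ℤ) else (z.1.val : ℤ) - S),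
            (if 2 * z.2.1.val < S then (z.2.1.val : ℤ) else (z.2.1.val : ℤ) - S),
            (if 2 * z.2.2.val < S then (z.2.2.val : ℤ) else (z.2.2.val : ℤ) - S)] : Fin 4 → ℤ) k.succ : ℝ) : ℝ) : ℂ)
      = 2 * Real.pi * I * ((q 0 : ℂ) * ((z.1 : ℕ) : ℂ) + (q 1 : ℂ) * ((z.2.1 : ℕ) : ℂ) +
          (q 2 : ℂ) * ((z.2.2 : ℕ) : ℂ)) / (S : ℂ) + ((q 0 * j₁ + q 1 * j₂ + q 2 * j₃ : ℤ) : ℂ) * (2 * Real.pi * I) := by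
    simp only [Fin.sum_univ_three, Fin.succ_zero_eq_one, Fin.succ_one_eq_two, Matrix.cons_val_one,
      Matrix.cons_val_zero]
    have e2 : (2 : Fin 3).succ = (3 : Fin 4) := rfl
    simp only [e2, Matrix.cons_val]  -- evaluate `![..] 3`
    rw [hj₁, hj₂, hj₃]
    push_cast
    field_simp
    ring
  rw [e, Complex.exp_add, Complex.exp_int_mul_two_pi_mul_I, mul_one]

/-- `‖a + b‖² − ‖a − b‖² = 4ab` for real `a, b` read in `ℂ`. [folklore] -/
theorem norm_sq_add_sub_norm_sq_sub (a b : ℝ) :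
    ‖((a : ℂ) + (b : ℂ))‖ ^ 2 - ‖((a : ℂ) - (b : ℂ))‖ ^ 2 = 4 * a * b := by
  rw [← Complex.ofReal_add, ← Complex.ofReal_sub, Complex.norm_real, Complex.norm_real, Real.norm_eq_abs,
    Real.norm_eq_abs, sq_abs, sq_abs]
  ring

end Summit.QuantumFields.YangMills.Theorems.SqueezedSkewnessHBAmps

end
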